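import Summits.SmoothPoincare4.SmoothPoincare4.Theorems.SullivanDualWitnessChargeKroneckerGlue
import Summits.SmoothPoincare4.SmoothPoincare4.Theorems.SullivanDualWitnessChargeKroneckerCompare

/-!
# Kronecker's existence theorem on sup-norm cubes of `ℝⁿ⁺¹` (homotopy form)

Crux `WitnessCharge` (stmt-SmoothPoincare4-7824), line `Sketch`, lead c6 — the topological engine of
the F5 programme (McDuff's cusp theorem via the twisted difference map). On `E = Fin (n+1) → ℝ`
with its sup norm (so that `closedBall 0 ρ` is a cube): let `F` be continuous on the cube of radius
`ρ`, let `P` be a `C¹` model whose zeros in the cube lie in the open cube of radius `ρ₀ < ρ`, are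
non-degenerate and have non-zero signed count `∑ sign det DP`, and let `H` be a jointly continuous
homotopy on the collar `ρ₀ ≤ ‖x‖ ≤ ρ` from `F` to `P` through zero-free maps. Then `F` has a zero in
the open cube of radius `ρ₀` (`helper_kronecker_exists_zero`). Classical: the Brouwer degree
`deg(F, cube, 0) = deg(P, cube, 0) = ∑ sign det DP ≠ 0` (Chang, *Methods in Nonlinear Analysis*
(2005), §3.1, Thm 3.1.4 (homotopy invariance) and Cor. 3.1.7 (Kronecker existence); Milnor, *Topology
from the Differentiable Viewpoint* (1965), §5). Proof here, by contradiction: if `F` has no zero in the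
small cube, the gluing lemma `helper_kronecker_glue` (unroll the homotopy radially, smooth, cut off)
produces a global `C¹` field `Φ`, equal to `P` outside a cube of radius `ρ₁ ∈ (ρ₀, ρ)` and zero-free
on the big cube; the torus comparison `helper_kronecker_compare` (both fields periodised against the
sine field, a common small regular shift by Sard, the flat-torus index theorem
`Literature.Topology.Euclidean.sum_sign_det_eq_zero_of_periodic` applied twice) then forces
`∑ sign det DP = 0`.
-/

noncomputable section

set_option linter.dupNamespace false

open Set Filter Metric Function

namespace Summit.SmoothPoincare4.SmoothPoincare4.Theorems.WitnessCharge.PencilIncompleteness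

/-- **Kronecker's existence theorem, homotopy form, on sup-norm cubes of `ℝⁿ⁺¹`.** If a continuous
field `F` on the cube `‖x‖ ≤ ρ` is homotopic on the collar `ρ₀ ≤ ‖x‖ ≤ ρ`, through zero-free maps,
to a `C¹` field `P` whose zeros in the cube are non-degenerate, lie in `‖x‖ < ρ₀`, and have non-zero
signed count, then `F` vanishes somewhere in `‖x‖ < ρ₀`.
[cite: Chang2005, §3.1, Thm 3.1.4 and Cor. 3.1.7] -/
theorem helper_kronecker_exists_zero :
    ∀ (n : ℕ) (ρ₀ ρ : ℝ) (F P : (Fin (n + 1) → ℝ) → (Fin (n + 1) → ℝ))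
      (H : ℝ → (Fin (n + 1) → ℝ) → (Fin (n + 1) → ℝ)) (S : Finset (Fin (n + 1) → ℝ)),
      0 < ρ₀ → ρ₀ < ρ →
      ContinuousOn F (Metric.closedBall 0 ρ) → ContDiff ℝ 1 P →
      (∀ x ∈ Metric.closedBall (0 : Fin (n + 1) → ℝ) ρ, P x = 0 →
        ‖x‖ < ρ₀ ∧ (fderiv ℝ P x).det ≠ 0) →
      (∀ x : Fin (n + 1) → ℝ, x ∈ S ↔ ‖x‖ < ρ₀ ∧ P x = 0) →
      ∑ x ∈ S, Real.sign (fderiv ℝ P x).det ≠ 0 →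
      ContinuousOn (Function.uncurry H)
        (Set.Icc (0 : ℝ) 1 ×ˢ (Metric.closedBall 0 ρ \ Metric.ball 0 ρ₀)) →
      (∀ x : Fin (n + 1) → ℝ, ρ₀ ≤ ‖x‖ → ‖x‖ ≤ ρ → H 0 x = F x ∧ H 1 x = P x) →
      (∀ s ∈ Set.Icc (0 : ℝ) 1, ∀ x : Fin (n + 1) → ℝ, ρ₀ ≤ ‖x‖ → ‖x‖ ≤ ρ → H s x ≠ 0) →
      ∃ x ∈ Metric.ball (0 : Fin (n + 1) → ℝ) ρ₀, F x = 0 := by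
  intro n ρ₀ ρ F P H S hρ₀ hρ hF hP hPz hS hsum hH hH01 hHne
  by_contra hno
  push Not at hno
  -- `F` is then zero-free on the small closed cube (on its boundary `F = H 0 ≠ 0`)
  have hF0 : ∀ x ∈ Metric.closedBall (0 : Fin (n + 1) → ℝ) ρ₀, F x ≠ 0 := by
    intro x hx
    rcases eq_or_lt_of_le (mem_closedBall_zero_iff.1 hx) with h | h
    · rw [← (hH01 x h.ge (h.le.trans hρ.le)).1]
      exact hHne 0 ⟨le_rfl, zero_le_one⟩ x h.ge (h.le.trans hρ.le)
    · exact hno x (mem_ball_zero_iff.2 h)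
  -- glue: a global `C¹` field, `= P` outside a cube of radius `ρ₁`, zero-free on the big cube
  obtain ⟨Φ, ρ₁, hρ₀₁, hρ₁, hΦ, hΦP, hΦne⟩ :=
    helper_kronecker_glue n ρ₀ ρ F P H hρ₀ hρ hF hP hH hH01 hHne hF0
  -- compare on the flat torus: the signed zero count of `P` in the cube `ρ₁` vanishes
  have key := helper_kronecker_compare n ρ₁ P Φ S (hρ₀.trans hρ₀₁) hP hΦ
    (fun x hx => (hΦP x hx).symm)
    (fun x hx => hΦne x (mem_closedBall_zero_iff.2 (hx.trans hρ₁.le)))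
    (fun x hx hx0 => (hPz x (mem_closedBall_zero_iff.2 (hx.trans hρ₁.le)) hx0).2)
    (fun x => by
      rw [hS x]
      constructor
      · rintro ⟨hx, hx0⟩; exact ⟨hx.trans hρ₀₁, hx0⟩
      · rintro ⟨hx, hx0⟩
        exact ⟨(hPz x (mem_closedBall_zero_iff.2 (hx.le.trans hρ₁.le)) hx0).1, hx0⟩)
  exact hsum key

end Summit.SmoothPoincare4.SmoothPoincare4.Theorems.WitnessCharge.PencilIncompleteness
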